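import Summits.BirchSwinnertonDyer.BirchSwinnertonDyer.Theorems.TameQuarticSolventTprimeFormalGroupDichotomyAtThree
import Summits.BirchSwinnertonDyer.BirchSwinnertonDyer.Theorems.TameQuarticSolventTprimeFormalTorsionNewtonSlopes
import Literature.NumberTheory.EllipticCurves.FormalMulThreeHeightDichotomyProofs
import Literature.NumberTheory.EllipticCurves.FormalGroupMultiplicationUniversalProofs
import HarnessLib

/-!
# Route `TameQuarticSolvent`, crux `SolventPairLowerBound` (stmt-BirchSwinnertonDyer-21391) — the VALUATIONS OF
# THE FORMAL `3`-TORSION of the (t′) good model over the tame quartic ring (Lubin's Newton polygon of `[3]`)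

HONEST FRAMING. Theorems only; helper (`--supports stmt-BirchSwinnertonDyer-21391 --as helper`) of width seat
bsd-wall-tqs-p1-w2 g7; sequel of w3 g5's `TameQuarticSolventTprimeFormalGroupDichotomyAtThree` (p596942), whose memo
`Cruxes/SolventPairLowerBound/TPRIME-LOCAL-SHAPE-w3g5.md` lists as NOT DONE «the valuation profile of the 3-torsion
({1/4, 1/12} / {1/8}) … (needs formal-group point valuations over ramified 𝒪 — the tree has only the chart
calculus)». BSD is not proved by any of this; nothing here closes 21391 or 23963.

WHAT. Let `W'` be the `ϖᵏ`-rescaled good model over a ring `O` with `3 = ϖ⁴u` produced by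
`tprime_goodModel_formalMul_three_dichotomy`, and let `ψ : O → K` be any ring map into an ultrametric normed field
with `‖ψ x‖ ≤ 1`, `0 < ‖ψ ϖ‖ < 1` (a completion of the quartic field at `w ∣ 3`, any algebraic extension of it, `ℂ₃`, …).
A **formal `3`-torsion parameter** of `W'` over `K` is a `t ∈ K`, `0 < ‖t‖ < 1`, with `Σₙ ψ([tⁿ][3]_{W'})·tⁿ = 0`.
Writing `ϱ = ‖ψ ϖ‖` (so `‖3‖ = ϱ⁴`):

* case B (`3 ∣ a₂`, Kobayashi congruence `[3] ≡ h(t⁹) (mod 3)`): every formal `3`-torsion parameter has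
  **`‖t‖² = ϱ`** (`v(t) = v(3)/8`: ONE slope, the segment `(1, v(3))—(9, 0)`);
* case A (`a₂ = ϖ²·unit`, `[t³][3] ≡ 4a₂ (mod 3)`): **`‖t‖ = ϱ` or `‖t‖³ = ϱ`** (`v(t) ∈ {v(3)/4, v(3)/12}`: TWO
  slopes, vertices `(1, v(3))`, `(3, v(3)/2)`, `(9, 0)` — the break at `3` is the canonical subgroup of order `3`);
* consequently (case B) NO formal `3`-torsion parameter exists over any `K` whose value group is `ϱ^{(1/m)ℤ}` with
  `m` odd — the quartic completion itself (`m = 1`) and every layer of its `3`-cyclotomic tower (`m = 3ⁿ`).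

Ingredients (all tree theorems over arbitrary rings): `[t¹][n] = n` (`coeff_one_formalMul'`), AEC IV.4.4
`[tᵏ][p] ∈ (p)` for `p ∤ k` (`coeff_formalMul_prime_mem_span`), oddness of `[n]` on `a₁ = a₃ = 0`
(`rescale_neg_one_formalMul`), the characteristic-`3` height dichotomy (`coeff_nine_formalMul_three_ne_zero`: `Δ ≠ 0`,
`b₂ = 0` ⇒ `[t⁹][3] ≠ 0`) read in the residue field of `K`, and the ultrametric «isolated dominant term» principle for
convergent series (companion file `TameQuarticSolventTprimeFormalTorsionNewtonSlopes`).

References: J. Lubin, Ann. of Math. 80 (1964) §1 (Newton polygon of `[p]`, valuations of torsion points);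
J. H. Silverman, *AEC* IV.4.4, IV.6.1, IV.7.5; N. Katz, *p-adic properties of modular schemes and modular forms*
(Antwerp III, LNM 350) Thm. 3.10.7 (canonical subgroup: the `p − 1`… here `2` points of largest valuation).
[cite: SilvermanAEC2009, IV.6.1 and IV.7.5]
-/

-- D-0017: single-problem summit, so `Summit.BirchSwinnertonDyer.BirchSwinnertonDyer.…` repeats a namespace BY DESIGN.
set_option linter.dupNamespace false

noncomputable section

open PowerSeries

namespace Summit.BirchSwinnertonDyer.BirchSwinnertonDyer.Theorems.SolventPairLowerBound

/-! ## §1. The good model over an ultrametric field receiving `O`: coefficient norms and the torsion profile -/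

section GoodModel

open WeierstrassCurve

variable {O : Type*} [CommRing O] {K : Type*} [NormedField K] [IsUltrametricDist K]

omit [IsUltrametricDist K] in
/-- Units of `O` go to norm-`1` elements under an integral map `ψ : O → K`. [folklore] -/
theorem norm_map_eq_one_of_isUnit (ψ : O →+* K) (hψ : ∀ x, ‖ψ x‖ ≤ 1) {u : O} (hu : IsUnit u) :
    ‖ψ u‖ = 1 := by
  obtain ⟨w, hw⟩ := hu.exists_right_inv
  have h : ‖ψ u‖ * ‖ψ w‖ = 1 := by rw [← norm_mul, ← map_mul, hw, map_one, norm_one]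
  have h1 : ‖ψ u‖ ≤ 1 := hψ u
  have h2 : ‖ψ w‖ ≤ 1 := hψ w
  nlinarith [norm_nonneg (ψ u), norm_nonneg (ψ w)]

omit [IsUltrametricDist K] in
/-- `x ∈ (a)` ⇒ `‖ψ x‖ ≤ ‖ψ a‖` under an integral map. [folklore] -/
theorem norm_map_le_of_mem_span (ψ : O →+* K) (hψ : ∀ x, ‖ψ x‖ ≤ 1) {x a : O}
    (hx : x ∈ Ideal.span {a}) : ‖ψ x‖ ≤ ‖ψ a‖ := by
  obtain ⟨y, rfl⟩ := Ideal.mem_span_singleton'.mp hx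
  rw [map_mul, norm_mul]
  exact (mul_le_mul_of_nonneg_right (hψ y) (norm_nonneg _)).trans (by rw [one_mul])

omit [IsUltrametricDist K] in
/-- `‖3‖ = ‖ψ ϖ‖⁴` when `3 = ϖ⁴u` with `u` a unit. [folklore] -/
theorem norm_three_eq_pow_four (ψ : O →+* K) (hψ : ∀ x, ‖ψ x‖ ≤ 1) {ϖ u : O} (hu : IsUnit u)
    (h3 : (3 : O) = ϖ ^ 4 * u) : ‖(3 : K)‖ = ‖ψ ϖ‖ ^ 4 := by
  rw [← map_ofNat ψ 3, h3, map_mul, map_pow, norm_mul, norm_pow, norm_map_eq_one_of_isUnit ψ hψ hu, mul_one]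

/-- **Supersingular height two, read in the residue field of `K`.** For a Weierstrass curve over `O` with unit
discriminant, `a₁ = 0` and `‖ψ a₂‖ < 1`, mapped integrally into an ultrametric field with `‖3‖ < 1`: the degree-`9`
coefficient of `[3]` has norm `1` (the reduction is supersingular, `b₂ = 0`, so `[3] = ±b₈ t⁹ + …` with
`b₈ ≠ 0` by the tree's `coeff_nine_formalMul_three_ne_zero`). [Silverman AEC IV.7.5]
[cite: SilvermanAEC2009, IV.7.5] -/
theorem norm_map_coeff_nine_formalMul_three_eq_one (ψ : O →+* K) (hψ : ∀ x, ‖ψ x‖ ≤ 1)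
    (h3K : ‖(3 : K)‖ < 1) (W' : WeierstrassCurve O) (hΔ : IsUnit W'.Δ) (ha₁ : W'.a₁ = 0)
    (ha₂ : ‖ψ W'.a₂‖ < 1) : ‖ψ (PowerSeries.coeff 9 (W'.formalMul 3))‖ = 1 := by
  classical
  -- the valuation ring `A` of `K` and its residue field `k`
  let v : Valuation K NNReal := NormedField.valuation
  have hv : ∀ x : K, v x = ‖x‖₊ := fun x ↦ rfl
  let A : ValuationSubring K := v.valuationSubring
  have hmemA : ∀ x : K, x ∈ A ↔ ‖x‖ ≤ 1 := fun x ↦ by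
    change v x ≤ 1 ↔ _
    rw [hv, ← NNReal.coe_le_coe, coe_nnnorm, NNReal.coe_one]
  have hequiv : v.IsEquiv A.valuation := v.isEquiv_valuation_valuationSubring
  have hmax : ∀ a : A, a ∈ IsLocalRing.maximalIdeal A ↔ ‖(a : K)‖ < 1 := fun a ↦ by
    rw [ValuationSubring.valuation_lt_one_iff, ← hequiv.lt_one_iff_lt_one, hv, ← NNReal.coe_lt_coe,
      coe_nnnorm, NNReal.coe_one]
  let ψA : O →+* A := ψ.codRestrict A fun x ↦ (hmemA _).mpr (hψ x)
  have hψA : ∀ x, ((ψA x : A) : K) = ψ x := fun x ↦ rfl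
  let k := IsLocalRing.ResidueField A
  let π : A →+* k := IsLocalRing.residue A
  -- `char k = 3`
  have h3k : (3 : k) = 0 := by
    have h3A : (3 : A) ∈ IsLocalRing.maximalIdeal A := by
      rw [hmax]; exact_mod_cast h3K
    have := (IsLocalRing.residue_eq_zero_iff (3 : A)).mpr h3A
    rwa [map_ofNat] at this
  haveI : CharP k 3 := (CharP.charP_iff_prime_eq_zero Nat.prime_three).mpr h3k
  -- the reduced curve is nonsingular and supersingular
  set W'' : WeierstrassCurve k := W'.map (π.comp ψA) with hW''
  have hΔ'' : W''.Δ ≠ 0 := by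
    rw [hW'', WeierstrassCurve.map_Δ, RingHom.comp_apply]
    exact (IsLocalRing.residue_ne_zero_iff_isUnit _).mpr (hΔ.map ψA)
  have hb₂ : W''.b₂ = 0 := by
    have ha₂A : ψA W'.a₂ ∈ IsLocalRing.maximalIdeal A := by rw [hmax, hψA]; exact ha₂
    have : π (ψA W'.a₂) = 0 := (IsLocalRing.residue_eq_zero_iff _).mpr ha₂A
    simp only [hW'', WeierstrassCurve.b₂, WeierstrassCurve.map_a₁, WeierstrassCurve.map_a₂, RingHom.comp_apply,
      ha₁, map_zero, this]
    ring
  have h9 := W''.coeff_nine_formalMul_three_ne_zero hb₂ hΔ''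
  rw [hW'', ← map_formalMul, PowerSeries.coeff_map, RingHom.comp_apply,
    IsLocalRing.residue_ne_zero_iff_isUnit] at h9
  -- a unit of `A` has norm `1`
  have hlt : ¬ ‖ψ (PowerSeries.coeff 9 (W'.formalMul 3))‖ < 1 := by
    rw [← hψA, ← hmax]
    exact fun hmem ↦ (IsLocalRing.mem_maximalIdeal _ |>.mp hmem) h9
  exact le_antisymm (hψ _) (not_lt.mp hlt)

variable (ψ : O →+* K) (hψ : ∀ x, ‖ψ x‖ ≤ 1) {ϖ u : O} (hu : IsUnit u) (h3 : (3 : O) = ϖ ^ 4 * u)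
  (hϖ0 : 0 < ‖ψ ϖ‖) (hϖ1 : ‖ψ ϖ‖ < 1)
include hψ hu h3 hϖ0 hϖ1

/-- **Case B (Kobayashi congruence) ⇒ one slope.** For the good model `W'` over `O` (`3 = ϖ⁴u`) with unit
discriminant, `a₁ = 0`, `3 ∣ a₂` and `[tⁿ][3] ∈ (3)` for `9 ∤ n`: every formal `3`-torsion parameter `t` over
an ultrametric field `K` receiving `O` integrally (`0 < ‖t‖ < 1`, `Σ ψ([tⁿ][3]) tⁿ = 0`) has
`‖t‖² = ‖ψ ϖ‖`, i.e. `v(t) = v(3)/8`. [Lubin 1964 §1; Silverman AEC IV.6.1] [cite: SilvermanAEC2009, IV.6.1] -/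
theorem norm_sq_formalThreeTorsion_eq_of_congruence (W' : WeierstrassCurve O) (hΔ : IsUnit W'.Δ)
    (ha₁ : W'.a₁ = 0) (ha₂ : (3 : O) ∣ W'.a₂)
    (hcong : ∀ n : ℕ, ¬ 9 ∣ n → PowerSeries.coeff n (W'.formalMul 3) ∈ Ideal.span {(3 : O)})
    {t : K} (ht0 : t ≠ 0) (ht1 : ‖t‖ < 1)
    (htors : HasSum (fun n ↦ ψ (PowerSeries.coeff n (W'.formalMul 3)) * t ^ n) 0) :
    ‖t‖ ^ 2 = ‖ψ ϖ‖ := by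
  have h3K : ‖(3 : K)‖ = ‖ψ ϖ‖ ^ 4 := norm_three_eq_pow_four ψ hψ hu h3
  have h3K1 : ‖(3 : K)‖ < 1 := by rw [h3K]; exact pow_lt_one₀ (norm_nonneg _) hϖ1 four_ne_zero
  have hψ3 : ‖ψ 3‖ = ‖ψ ϖ‖ ^ 4 := by rw [map_ofNat, h3K]
  refine norm_sq_eq_of_hasSum_zero_oneSlope hϖ0 (fun n ↦ hψ _) ?_ ?_ ?_ ?_ ht0 ht1 htors
  · rw [PowerSeries.coeff_zero_eq_constantCoeff_apply, W'.constantCoeff_formalMul, map_zero]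
  · rw [W'.coeff_one_formalMul', Nat.cast_ofNat, hψ3]
  · have ha₂' : ‖ψ W'.a₂‖ < 1 := by
      obtain ⟨y, hy⟩ := ha₂
      rw [hy, map_mul, norm_mul, map_ofNat]
      exact (mul_le_of_le_one_right (norm_nonneg _) (hψ y)).trans_lt h3K1
    exact norm_map_coeff_nine_formalMul_three_eq_one ψ hψ h3K1 W' hΔ ha₁ ha₂'
  · intro n hn
    rw [← hψ3]
    exact norm_map_le_of_mem_span ψ hψ (hcong n hn)

/-- **Case A (canonical subgroup) ⇒ two slopes.** For the good model `W'` over `O` (`3 = ϖ⁴u`) with unit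
discriminant, `a₁ = a₃ = 0`, `a₂ = ϖ²·(unit)` and `[t³][3] ≡ 4a₂ (mod 3)`: every formal `3`-torsion parameter `t`
over an ultrametric field `K` receiving `O` integrally has `‖t‖ = ‖ψ ϖ‖` or `‖t‖³ = ‖ψ ϖ‖`, i.e.
`v(t) ∈ {v(3)/4, v(3)/12}` (the two points with `v = v(3)/4` span the canonical subgroup).
[Lubin 1964 §1; Katz 1973 Thm. 3.10.7] [cite: SilvermanAEC2009, IV.6.1] -/
theorem norm_formalThreeTorsion_eq_or_of_canonical (W' : WeierstrassCurve O) (hΔ : IsUnit W'.Δ)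
    (ha₁ : W'.a₁ = 0) (ha₃ : W'.a₃ = 0) (ha₂ : ∃ s₀ : O, IsUnit s₀ ∧ W'.a₂ = ϖ ^ 2 * s₀)
    (hc₃ : PowerSeries.coeff 3 (W'.formalMul 3) - 4 * W'.a₂ ∈ Ideal.span {(3 : O)})
    {t : K} (ht0 : t ≠ 0) (ht1 : ‖t‖ < 1)
    (htors : HasSum (fun n ↦ ψ (PowerSeries.coeff n (W'.formalMul 3)) * t ^ n) 0) :
    ‖t‖ = ‖ψ ϖ‖ ∨ ‖t‖ ^ 3 = ‖ψ ϖ‖ := by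
  haveI : Fact (Nat.Prime 3) := ⟨Nat.prime_three⟩
  have h3K : ‖(3 : K)‖ = ‖ψ ϖ‖ ^ 4 := norm_three_eq_pow_four ψ hψ hu h3
  have h3K1 : ‖(3 : K)‖ < 1 := by rw [h3K]; exact pow_lt_one₀ (norm_nonneg _) hϖ1 four_ne_zero
  have hψ3 : ‖ψ 3‖ = ‖ψ ϖ‖ ^ 4 := by rw [map_ofNat, h3K]
  have h4K : ‖(4 : K)‖ = 1 := by
    have h : (4 : K) = 1 + 3 := by norm_num
    have hne : ‖(1 : K)‖ ≠ ‖(3 : K)‖ := by rw [norm_one]; exact (ne_of_lt h3K1).symm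
    rw [h, IsUltrametricDist.norm_add_eq_max_of_norm_ne_norm hne, norm_one, max_eq_left h3K1.le]
  obtain ⟨s₀, hs₀, ha₂e⟩ := ha₂
  have hψa₂ : ‖ψ W'.a₂‖ = ‖ψ ϖ‖ ^ 2 := by
    rw [ha₂e, map_mul, map_pow, norm_mul, norm_pow, norm_map_eq_one_of_isUnit ψ hψ hs₀, mul_one]
  have hϖ2 : ‖ψ ϖ‖ ^ 4 < ‖ψ ϖ‖ ^ 2 := pow_lt_pow_right_of_lt_one₀ hϖ0 hϖ1 (by norm_num)
  refine norm_eq_or_norm_cube_eq_of_hasSum_zero_twoSlopes hϖ0 hϖ1 (fun n ↦ hψ _) ?_ ?_ ?_ ?_ ?_ ?_ ht0 ht1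
    htors
  · rw [PowerSeries.coeff_zero_eq_constantCoeff_apply, W'.constantCoeff_formalMul, map_zero]
  · rw [W'.coeff_one_formalMul', Nat.cast_ofNat, hψ3]
  · -- `‖ψ c₃ - 4ψ(a₂)‖ ≤ ‖3‖ < ‖4ψ(a₂)‖ = ϱ²`
    have hle : ‖ψ (PowerSeries.coeff 3 (W'.formalMul 3)) - 4 * ψ W'.a₂‖ ≤ ‖ψ ϖ‖ ^ 4 := by
      have := norm_map_le_of_mem_span ψ hψ hc₃
      rwa [map_sub, map_mul, map_ofNat, hψ3] at this
    have h4a : ‖(4 : K) * ψ W'.a₂‖ = ‖ψ ϖ‖ ^ 2 := by rw [norm_mul, h4K, one_mul, hψa₂]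
    rw [← h4a]
    exact Literature.NumberTheory.EllipticCurves.norm_eq_of_norm_sub_lt' (by rw [h4a]; exact hle.trans_lt hϖ2)
  · rw [coeff_formalMul_eq_zero_of_even W' ha₁ ha₃ 3 (by decide), map_zero]
  · have ha₂' : ‖ψ W'.a₂‖ < 1 := by rw [hψa₂]; exact pow_lt_one₀ (norm_nonneg _) hϖ1 two_ne_zero
    exact norm_map_coeff_nine_formalMul_three_eq_one ψ hψ h3K1 W' hΔ ha₁ ha₂'
  · intro n hn
    rw [← hψ3]
    exact norm_map_le_of_mem_span ψ hψ (W'.coeff_formalMul_prime_mem_span 3 hn)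

omit [IsUltrametricDist K] hψ hu h3 in
/-- **No formal `3`-torsion over value groups of odd index (case B).** If every nonzero `x ∈ K` has
`‖x‖ᵐ ∈ ‖ψ ϖ‖^ℤ` for some ODD `m` (the quartic completion itself, `m = 1`; the `n`-th layer of its `3`-cyclotomic
tower, `m = 3ⁿ`; any extension of odd ramification index over it), then `‖t‖² = ‖ψ ϖ‖` has no solution
`t ≠ 0`: the one-slope profile excludes formal `3`-torsion parameters. [folklore] -/
theorem eq_zero_of_norm_sq_eq_of_oddIndex {m : ℕ} (hm : Odd m)
    (hval : ∀ x : K, x ≠ 0 → ∃ k : ℤ, ‖x‖ ^ m = ‖ψ ϖ‖ ^ k) {t : K} (ht : ‖t‖ ^ 2 = ‖ψ ϖ‖) : t = 0 := by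
  by_contra ht0
  obtain ⟨k, hk⟩ := hval t ht0
  have h : ‖ψ ϖ‖ ^ ((m : ℤ)) = ‖ψ ϖ‖ ^ (k * 2) := by
    rw [zpow_mul, ← hk, zpow_natCast, zpow_ofNat, ← pow_mul, ← ht, ← pow_mul, mul_comm]
  have hinj : (m : ℤ) = k * 2 := (zpow_right_strictAnti₀ hϖ0 hϖ1).injective h
  obtain ⟨j, rfl⟩ := hm
  omega

end GoodModel

/-! ## §2. From `ℚ`: the formal `3`-torsion profile of the (t′) leaf over the tame quartic ring -/

section RatLevel

open WeierstrassCurve Literature.NumberTheory.EllipticCurves.Rank1Residual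
  Summit.BirchSwinnertonDyer.Rank1Residual.Additive

/-- **The formal `3`-torsion valuation profile of the (t′) leaf (Lubin's Newton polygon of `[3]` on the good
model).** For `W/ℚ` globally minimal, elliptic, `Addv W 3`, `SubTprime W 3`, and any commutative ring `O` with
`φ : ℤ₃ → O`, `3 = ϖ⁴u`, `u ∈ Oˣ`, `ϖ ∉ Oˣ`: the `ϖᵏ`-rescaled good model `W'` of w3 g5's
`tprime_goodModel_formalMul_three_dichotomy` (unit discriminant, `a₁ = a₃ = 0`) has the following property. For
every ultrametric normed field `K` receiving `O` integrally (`‖ψ x‖ ≤ 1`, `0 < ‖ψ ϖ‖ < 1` — a completion of the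
solvent quartic field at `w ∣ 3`, any algebraic extension, `ℂ₃`) and every formal `3`-torsion parameter `t ∈ K`
of `W'` (`0 < ‖t‖ < 1`, `Σₙ ψ([tⁿ][3]_{W'}) tⁿ = 0`): EITHER `W` is on sub-row B (`c₆ = 0 ∨ ord₃ c₆ ≥ m + 2`) and
`‖t‖² = ‖ψ ϖ‖` (`v(t) = v(3)/8`), OR `W` is on sub-row A (`ord₃ c₆ = m`) and `‖t‖ = ‖ψ ϖ‖ ∨ ‖t‖³ = ‖ψ ϖ‖`
(`v(t) ∈ {v(3)/4, v(3)/12}`). This is the «valuation profile {1/4, 1/12} / {1/8}» of memo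
TPRIME-LOCAL-SHAPE-w3g5 §1 as a theorem about the formal group (the identification `E₁(K) ≅ Ê(𝔪_K)`, AEC VII.2.2,
is in the tree only over `ℚ_p`, so the statement is kept on the formal-group side). CONDITIONAL on nothing;
credits nothing toward 21391. [Lubin 1964 §1; Silverman AEC IV.6.1, IV.7.5] [cite: SilvermanAEC2009, IV.6.1] -/
theorem tprime_goodModel_formalThreeTorsion_norm_dichotomy (W : WeierstrassCurve ℚ) [W.IsElliptic]
    [W.IsGloballyMinimal] (hadd : Addv W 3) (hsub : SubTprime W 3)
    {O : Type*} [CommRing O] (φ : ℤ_[3] →+* O) {ϖ u : O} (hu : IsUnit u) (h3 : (3 : O) = ϖ ^ 4 * u)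
    (hϖ : ¬ IsUnit ϖ) :
    ∃ (V : WeierstrassCurve ℤ_[3]) (T : WeierstrassCurve.VariableChange ℤ_[3]) (k m : ℕ)
      (W' : WeierstrassCurve O),
      V.map (algebraMap ℤ_[3] ℚ_[3]) = W.baseChange ℚ_[3] ∧ ((k = 1 ∧ m = 3) ∨ (k = 3 ∧ m = 6)) ∧
      padicValRat 3 W.Δ = 3 * k ∧ W'.a₁ = 0 ∧ W'.a₃ = 0 ∧
      ϖ ^ (2 * k) * W'.a₂ = φ (T • V).a₂ ∧ ϖ ^ (4 * k) * W'.a₄ = φ (T • V).a₄ ∧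
      ϖ ^ (6 * k) * W'.a₆ = φ (T • V).a₆ ∧ IsUnit W'.Δ ∧
      ∀ {K : Type*} [NormedField K] [IsUltrametricDist K] (ψ : O →+* K), (∀ x, ‖ψ x‖ ≤ 1) →
        0 < ‖ψ ϖ‖ → ‖ψ ϖ‖ < 1 → ∀ t : K, t ≠ 0 → ‖t‖ < 1 →
        HasSum (fun n ↦ ψ (PowerSeries.coeff n (W'.formalMul 3)) * t ^ n) 0 →
          ((W.c₆ = 0 ∨ (m + 2 : ℤ) ≤ padicValRat 3 W.c₆) ∧ ‖t‖ ^ 2 = ‖ψ ϖ‖) ∨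
          ((W.c₆ ≠ 0 ∧ padicValRat 3 W.c₆ = m) ∧ (‖t‖ = ‖ψ ϖ‖ ∨ ‖t‖ ^ 3 = ‖ψ ϖ‖)) := by
  obtain ⟨V, T, k, m, W', hVmap, hkm, hΔval, -, -, hW'a₁, hW'a₃, ha₂, ha₄, ha₆, hunit, hcases⟩ :=
    tprime_goodModel_formalMul_three_dichotomy W hadd hsub φ hu h3 hϖ
  refine ⟨V, T, k, m, W', hVmap, hkm, hΔval, hW'a₁, hW'a₃, ha₂, ha₄, ha₆, hunit, ?_⟩
  intro K _ _ ψ hψ hϖ0 hϖ1 t ht0 ht1 htors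
  rcases hcases with ⟨hB1, hB2, hB3⟩ | ⟨hA1, hA2, hA3⟩
  · exact Or.inl ⟨hB2, norm_sq_formalThreeTorsion_eq_of_congruence ψ hψ hu h3 hϖ0 hϖ1 W' hunit hW'a₁ hB1
      hB3 ht0 ht1 htors⟩
  · exact Or.inr ⟨hA2, norm_formalThreeTorsion_eq_or_of_canonical ψ hψ hu h3 hϖ0 hϖ1 W' hunit hW'a₁ hW'a₃
      hA1 hA3 ht0 ht1 htors⟩

/-- **Sub-row B: the good model has NO formal `3`-torsion over value groups of odd index** — in particular over
the completion `M_w` of the solvent quartic field itself (`‖·‖ ∈ ‖ϖ‖^ℤ`, `m = 1`) and over every layer of its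
`3`-cyclotomic tower (`e(M_w(μ_{3ⁿ})/M_w) = 3ⁿ⁻¹` odd; `μ₃ ⊂ M_w^{nr}` since `√3 = ϖ² ∈ M_w`): for `W` on
sub-row B (`c₆ = 0 ∨ ord₃ c₆ ≥ m + 2`) and any ultrametric `K` receiving `O` integrally in which every nonzero `x`
has `‖x‖^{m'} ∈ ‖ψ ϖ‖^ℤ` with `m'` odd, the only `t` with `‖t‖ < 1` and `Σₙ ψ([tⁿ][3]_{W'}) tⁿ = 0` is `t = 0`
(memo TPRIME-LOCAL-SHAPE-w3g5 §1 «all 3-torsion of valuation 1/8 ⇒ E(M(μ_{3^∞}))[3^∞] ∩ Ê = 0», formal side).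
[Lubin 1964 §1] [cite: SilvermanAEC2009, IV.6.1] -/
theorem tprime_goodModel_no_formalThreeTorsion_of_subrowB_oddIndex (W : WeierstrassCurve ℚ) [W.IsElliptic]
    [W.IsGloballyMinimal] (hadd : Addv W 3) (hsub : SubTprime W 3)
    {O : Type*} [CommRing O] (φ : ℤ_[3] →+* O) {ϖ u : O} (hu : IsUnit u) (h3 : (3 : O) = ϖ ^ 4 * u)
    (hϖ : ¬ IsUnit ϖ) :
    ∃ (V : WeierstrassCurve ℤ_[3]) (T : WeierstrassCurve.VariableChange ℤ_[3]) (k m : ℕ)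
      (W' : WeierstrassCurve O),
      V.map (algebraMap ℤ_[3] ℚ_[3]) = W.baseChange ℚ_[3] ∧ ((k = 1 ∧ m = 3) ∨ (k = 3 ∧ m = 6)) ∧
      padicValRat 3 W.Δ = 3 * k ∧ W'.a₁ = 0 ∧ W'.a₃ = 0 ∧
      ϖ ^ (2 * k) * W'.a₂ = φ (T • V).a₂ ∧ ϖ ^ (4 * k) * W'.a₄ = φ (T • V).a₄ ∧
      ϖ ^ (6 * k) * W'.a₆ = φ (T • V).a₆ ∧ IsUnit W'.Δ ∧
      ((W.c₆ = 0 ∨ (m + 2 : ℤ) ≤ padicValRat 3 W.c₆) →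
        ∀ {K : Type*} [NormedField K] [IsUltrametricDist K] (ψ : O →+* K), (∀ x, ‖ψ x‖ ≤ 1) →
          0 < ‖ψ ϖ‖ → ‖ψ ϖ‖ < 1 → ∀ {m' : ℕ}, Odd m' → (∀ x : K, x ≠ 0 → ∃ j : ℤ, ‖x‖ ^ m' = ‖ψ ϖ‖ ^ j) →
          ∀ t : K, ‖t‖ < 1 → HasSum (fun n ↦ ψ (PowerSeries.coeff n (W'.formalMul 3)) * t ^ n) 0 →
            t = 0) := by
  obtain ⟨V, T, k, m, W', hVmap, hkm, hΔval, hW'a₁, hW'a₃, ha₂, ha₄, ha₆, hunit, hprof⟩ :=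
    tprime_goodModel_formalThreeTorsion_norm_dichotomy W hadd hsub φ hu h3 hϖ
  refine ⟨V, T, k, m, W', hVmap, hkm, hΔval, hW'a₁, hW'a₃, ha₂, ha₄, ha₆, hunit, ?_⟩
  intro hB K _ _ ψ hψ hϖ0 hϖ1 m' hm' hval t ht1 htors
  by_contra ht0
  rcases hprof ψ hψ hϖ0 hϖ1 t ht0 ht1 htors with ⟨-, hsq⟩ | ⟨⟨hc₆, hval₆⟩, -⟩
  · exact ht0 (eq_zero_of_norm_sq_eq_of_oddIndex ψ hϖ0 hϖ1 hm' hval hsq)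
  · rcases hB with h0 | hle
    · exact hc₆ h0
    · rw [hval₆] at hle
      exact absurd hle (by omega)

end RatLevel

end Summit.BirchSwinnertonDyer.BirchSwinnertonDyer.Theorems.SolventPairLowerBound

end
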